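import Summits.BirchSwinnertonDyer.BirchSwinnertonDyer.Theorems.ClassRecordThreeKernelUpper
import Summits.BirchSwinnertonDyer.BirchSwinnertonDyer.Theorems.ClassRecordThreeStepLOfHalvesB
import HarnessLib

/-!
# Routes `ClassRecordThree` / `KolyvaginRoadThree` (rung K2@3): the two `closes` kernels RE-KEYED on the
# ORIENTATION-REPAIRED H3 atom `Three.IMCDivAt₃B` — one-token twins of `ClassRecordThreeKernelUpper`
# (plan g30 RULING 1 (E) ∕ RULING 2 (G4) «EDIT SHAPES OF RECORD»; ORIENT-AUDIT-19270 form (a) at `p = 3`)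

Cell `bsd-stepL` (run/shared/lean/pub/bsd-stepL/), seat `bsd-stepL-bdp` (prover g16, 2026-08-27).
`--supports stmt-BirchSwinnertonDyer-19494 --as helper` (K2@3; the KOLY twin serves 19506). Theorems only; no
definition, no named fact, no `sorry`; NO new mathematics beyond the companion's T = 0 re-thread
(`Three.stepLAt_of_halves₃_of_classX11bB`, `Theorems/ClassRecordThreeStepLOfHalvesB.lean`).

## What this file does

`Theorems/ClassRecordThreeKernelUpper.lean` (shim-p1 g2; the terms both routes' `closes` call) consumes the H3
half `Three.IMCDivAt₃ W` through the binders `hHb` ∕ `hHd` (`… → BDPValueAt₃ W ∧ IMCDivAt₃ W`) at exactly two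
lines each, `stepLAt_of_halves₃_of_classX11b … (hH_ …).1 (hH_ …).2`. The cell's audit of record
(ORIENT-AUDIT-19270, referee g38 PASS, plan g30 RULING 1) found that atom MIS-ORIENTED (X-slot at the frame's own
prime); the repaired atom is `Three.IMCDivAt₃B` (X-slot at the OTHER prime; `Theorems/ClassRecordThreeIMCDivAtThreeB.lean`).
Here:

* §1 `multiplicativeRankOneAtThree_of_classRecord_upperB` — `…_of_classRecord_upper` VERBATIM with `hHb` ∕ `hHd`
  re-typed over `BDPValueAt₃ W ∧ IMCDivAt₃B W` and the two call sites swapped to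
  `stepLAt_of_halves₃_of_classX11bB`; every other binder byte-identical (so the K2@3 `closes` re-certifies by the
  one-token edit `…_upper ↦ …_upperB` once its parent item is re-typed `HalvesAtThree ↦ HalvesAtThreeR`).
* §2 `multiplicativeRankOneAtThree_of_kolyRecord_upperB` — the same for the KOLY record (`hHb` on the Tamagawa
  cells, `hHd`), for `HalvesTamAtThree ↦ HalvesTamAtThreeR`.

HONEST FRAMING: kernel re-plumbing; CONDITIONAL on every binder; nothing booked; no census word, tier or label
moves (T7); O2 stays OPEN; BSD(E,3) is proved for no class by this file.

References: those of `ClassRecordThreeKernelUpper.lean` — [Castella2018] Thm. 2.3, Thm. 3.2, §5; [Skinner2016PacificMC]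
Thm. A, Thm. C; [SteinWuthrich2013] Thm. 6.1; [Disegni2020] Thm. 1; [MatarNekovar2019] Thm. 0.3; [Hsieh2014] Thm. 1;
[McCallumLMS1991] Cor. 5.6; [Wuthrich2014] Prop. 21; [Miller2011LMS] Def. 1.1; cell audit ORIENT-AUDIT-19270 Q4 (a).
-/

noncomputable section

open scoped Classical

open WeierstrassCurve NumberField IsDedekindDomain Field Literature.NumberTheory.EllipticCurves
  Rat.HeightOneSpectrum
  Literature.NumberTheory.DiophantineGeometry
  Literature.NumberTheory.EllipticCurves.GreenbergSelmer
  Literature.NumberTheory.EllipticCurves.ModularForms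
  Literature.NumberTheory.EllipticCurves.Rank1Residual
  Literature.NumberTheory.EllipticCurves.Rank1Residual.Typed
  Literature.NumberTheory.EllipticCurves.Wuthrich2014
  Literature.NumberTheory.EllipticCurves.BalakrishnanEtAl2019
  Literature.NumberTheory.EllipticCurves.Skinner2016
  Literature.NumberTheory.EllipticCurves.SteinWuthrich2013
  Literature.NumberTheory.EllipticCurves.Disegni2020
  Literature.NumberTheory.EllipticCurves.BarriosEtAl2025
  Literature.NumberTheory.QuadraticFields.Quadratic
  Literature.NumberTheory.Automorphic
  Literature.NumberTheory.GaloisRepresentations Literature.NumberTheory.GaloisCohomology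
  Summit.BirchSwinnertonDyer.Rank1Residual.X11b.AcSelmer
  Summit.BirchSwinnertonDyer.Rank1Residual.X11b.LocBridge
  Summit.BirchSwinnertonDyer.Rank1Residual
  Summit.BirchSwinnertonDyer.Rank1Residual.X11b
  Summit.BirchSwinnertonDyer.Rank1Residual.X11b.Three

-- the cell's Theorems namespace repeats the summit name (Summit.<Summit>.<Problem>), as in every sibling file
set_option linter.dupNamespace false

namespace Summit.BirchSwinnertonDyer.BirchSwinnertonDyer.Theorems

/-! ### §1. The K2@3 leaf from the class record, H3 ORIENTED -/

/-- **K2b leaf from the class record v4.5′ on the consumed bound, with the ORIENTED H3 atom.**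
`multiplicativeRankOneAtThree_of_classRecord_upper` VERBATIM except that the halves binders `hHb` (road (b):
(ram) ∧ split) and `hHd` (road (d): ¬(ram) ∧ surj) deliver `BDPValueAt₃ W ∧ IMCDivAt₃B W` — the BDP-side
divisibility with the Selmer X-slot at the prime OPPOSITE to the frame's (ORIENT-AUDIT-19270 form (a)) — and
`StepLAt W` is obtained from them by `stepLAt_of_halves₃_of_classX11bB` (the T = 0 re-thread: H2 read at the
conjugate datum, no rank input). Every other binder and every other proof line is byte-identical. CONDITIONAL on
every binder; nothing booked; O2 OPEN.
-- adapted from Summits/BirchSwinnertonDyer/BirchSwinnertonDyer/Theorems/ClassRecordThreeKernelUpper.lean (§2)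
[cite: Castella2018, Thm. 2.3 (p. 5), Thm. 3.2 (p. 9), §5 (p. 12)] [cite: Skinner2016PacificMC, Thm. A and Thm. C (§1)]
[cite: SteinWuthrich2013, Thm. 6.1, §4.2] [cite: Disegni2020, Thm. 1 (§1.2)] [cite: MatarNekovar2019, Thm. 0.3 (p. 456)]
[cite: Hsieh2014, Thm. 1 (arXiv:1112.1580 pp. 3–4)] [cite: Wuthrich2014, Prop. 21 (p. 400)] [cite: Miller2011LMS, Def. 1.1] -/
theorem multiplicativeRankOneAtThree_of_classRecord_upperB
    -- PUBLISHED: the named facts of route p2, WITHOUT `hEP` (as v4.5′)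
    (hGZ : ∀ (N : ℕ) [NeZero N] (W : WeierstrassCurve ℚ) (K : Type) [Field K] [NumberField K],
      gross_zagier N W K)
    (hKo : ∀ (N : ℕ) [NeZero N] (W : WeierstrassCurve ℚ) (K : Type) [Field K] [NumberField K],
      kolyvagin N W K)
    (hB : ∀ (N : ℕ) [NeZero N] (W : WeierstrassCurve ℚ) (K : Type) [Field K] [NumberField K],
      Kolyvagin1990_padicValNat_card_sha_le N W K)
    (hSk : Skinner2016.thmC_padicValRat_bsd_rank_zero) (hWu : sha_dvd_analyticSha)
    (hGZK : rank_eq_analyticRank_of_analyticRank_le_one) (hmod : hasEntireLFunction_rat)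
    (hnf : exists_isNewformOf) (hHL : HoffsteinLuo1997_exists_twist_L_one_ne_zero)
    (hMaz : mazur_not_dvd_maninConstant_of_odd)
    (hPT : ∀ (K : Type) [Field K] [NumberField K], poitouTate_sum_localTatePairing_eq_zero K)
    -- PUBLISHED: road (a)'s five, Matar–Nekovář 2019 Thm. 0.3, Hsieh 2014 Thm. 1 (NO `hFH`, NO `hBR`)
    (hSkA : thmA_charIdeal_multiplicative) (hJn : thm61_nonsplitMultiplicative)
    (hHn : exists_isMultCanonical) (hD : thm1_padicBSD_rankOne_multiplicative)
    (hpar : nonempty_modularParametrizationData)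
    (hMN : ∀ (N : ℕ) [NeZero N] (W : WeierstrassCurve ℚ) (K : Type) [Field K] [NumberField K],
      MatarNekovar2019.thm03_padicValNat_card_sha_le_of_irreducible N W K)
    (hH : hsieh2014_exists_anticyclotomicPAdicLFunction)
    -- ROAD (a) NONSPLIT(3) ∧ (ram): Schneider at 3
    (hReg : ∀ (W : WeierstrassCurve ℚ) [W.IsElliptic] [W.IsGloballyMinimal],
      ClassX11b W 3 → Ram W 3 → ¬ W.HasSplitMultiplicativeReductionAtPrime 3 →
        ClassClosure.RegulatorNonvanishingAt W 3)
    -- ROADS (b)/(d): the named descent residual …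
    (hDb : ∀ (W : WeierstrassCurve ℚ) [W.IsElliptic] [W.IsGloballyMinimal],
      ClassX11b W 3 → Ram W 3 → W.HasSplitMultiplicativeReductionAtPrime 3 → HsiehDescentAt₃ W)
    (hDd : ∀ (W : WeierstrassCurve ℚ) [W.IsElliptic] [W.IsGloballyMinimal],
      ClassX11b W 3 → ¬ Ram W 3 → Surj W 3 → HsiehDescentAt₃ W)
    -- … and the halves H2 ∧ H3
    (hHb : ∀ (W : WeierstrassCurve ℚ) [W.IsElliptic] [W.IsGloballyMinimal],
      ClassX11b W 3 → Ram W 3 → W.HasSplitMultiplicativeReductionAtPrime 3 →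
        BDPValueAt₃ W ∧ IMCDivAt₃B W)
    (hHd : ∀ (W : WeierstrassCurve ℚ) [W.IsElliptic] [W.IsGloballyMinimal],
      ClassX11b W 3 → ¬ Ram W 3 → Surj W 3 → BDPValueAt₃ W ∧ IMCDivAt₃B W)
    -- pure-(T2β)@3 on split ∧ (ram): the CONSUMED Euler-system half (replaces the displays binder `hSh`)
    (hUβ : ∀ (W : WeierstrassCurve ℚ) [W.IsElliptic] [W.IsGloballyMinimal],
      ClassX11b W 3 → Ram W 3 → W.HasSplitMultiplicativeReductionAtPrime 3 → ¬ ShapeAlpha W →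
        ¬ ShapeGamma W → 3 ∣ W.tamagawaProduct → Typed.MissingUpperBoundAt W 3)
    -- (T2′)₃ Euler-system halves (α, γ∖α split, ¬ram)
    (hUα : ∀ (W : WeierstrassCurve ℚ) [W.IsElliptic] [W.IsGloballyMinimal],
      ClassX11b W 3 → Ram W 3 → ShapeAlpha W → Typed.MissingUpperBoundAt W 3)
    (hUγ : ∀ (W : WeierstrassCurve ℚ) [W.IsElliptic] [W.IsGloballyMinimal],
      ClassX11b W 3 → Ram W 3 → W.HasSplitMultiplicativeReductionAtPrime 3 → ¬ ShapeAlpha W →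
        ShapeGamma W → Typed.MissingUpperBoundAt W 3)
    (hU₀ : ∀ (W : WeierstrassCurve ℚ) [W.IsElliptic] [W.IsGloballyMinimal],
      ClassX11b W 3 → Surj W 3 → ¬ Ram W 3 → Typed.MissingUpperBoundAt W 3)
    -- THE (T4″)₃ CORNER `¬Surj`
    (hCL : ∀ (W : WeierstrassCurve ℚ) [W.IsElliptic] [W.IsGloballyMinimal], CornerStepLAt W)
    (hCT : ∀ (W : WeierstrassCurve ℚ) [W.IsElliptic] [W.IsGloballyMinimal], CornerTwistAt W)
    (hCU : ∀ (W : WeierstrassCurve ℚ) [W.IsElliptic] [W.IsGloballyMinimal], CornerUpperAt W) :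
    MultiplicativeRankOneAtThree := by
  intro W _ _ hX
  have hEP : ∀ (K : Type) [Field K] [NumberField K] (v : HeightOneSpectrum (𝓞 K)),
      localEulerPoincareCharacteristic (v.adicCompletion K) :=
    GaloisImage.EP.localEulerPoincareCharacteristic_adicCompletion
  by_cases hram : Ram W 3
  · by_cases hs : W.HasSplitMultiplicativeReductionAtPrime 3
    · -- road (b): StepLAt W from the named descent residual + H2 ∧ H3 at W
      have hL : StepLAt W :=
        stepLAt_of_halves₃_of_classX11bB hnf hKo hPT hEP hX
          (bdpExistsAt₃_of_hsieh2014_of_descent W hH lambdaSupplyAt₃ (hDb W hX hram hs))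
          (hHb W hX hram hs).1 (hHb W hX hram hs).2
      exact Three.bsdp_three_of_surj_of_stepLAt_of_shapes_upper hGZ hKo hB hSk hWu hGZK hmod hnf hHL hMaz
        hPT hEP W hX (surj_of_irr_of_ram W 3 hX.2.2.2 hram) hL
        (fun hram hα hγ ht ↦ hUβ W hX hram hs hα hγ ht) (fun hram hα ↦ hUα W hX hram hα)
        (fun hram hα hγ ↦ hUγ W hX hram hs hα hγ) (fun h ↦ absurd hram h)
    · -- road (a)
      exact bsdp_of_ram_of_nonsplit_of_regulatorNonvanishing hSkA hJn hHn hD hGZK hpar W 3 hX hram hs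
        (hReg W hX hram hs)
  · by_cases hsurj : Surj W 3
    · -- road (d)
      have hL₀ : StepLAt W :=
        stepLAt_of_halves₃_of_classX11bB hnf hKo hPT hEP hX
          (bdpExistsAt₃_of_hsieh2014_of_descent W hH lambdaSupplyAt₃ (hDd W hX hram hsurj))
          (hHd W hX hram hsurj).1 (hHd W hX hram hsurj).2
      exact Three.bsdp_three_of_surj_of_stepLAt_of_shapes_upper hGZ hKo hB hSk hWu hGZK hmod hnf hHL hMaz
        hPT hEP W hX hsurj hL₀ (fun h _ _ _ ↦ absurd h hram) (fun h _ ↦ absurd h hram)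
        (fun h _ _ ↦ absurd h hram) (fun _ ↦ hU₀ W hX hsurj hram)
    · -- the corner, as v4.1: the ℚ-level Euler-system half from (U♯) + (Tw), then the split dichotomy
      have hU : ∀ (W : WeierstrassCurve ℚ) [W.IsElliptic] [W.IsGloballyMinimal],
          ClassX11b W 3 → ¬ Surj W 3 → 3 ∣ W.tamagawaProduct → Typed.MissingUpperBoundAt W 3 :=
        fun W _ _ hX hns ht ↦
          missingUpperBoundAt_of_cornerUpperAt hGZ hKo hGZK hmod hnf hHL hMaz W hX hns ht (hCU W) (hCT W)
      obtain ⟨hdvd, hnr⟩ := ClassX11b.dvd_and_not_ram_of_not_surj W 3 hX hsurj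
      refine Typed.bsdp_of_missingPPartAt W 3 hGZK (by rw [hX.1]) ?_
      by_cases hs : W.HasSplitMultiplicativeReductionAtPrime 3
      · exact missingPPartAt_of_corner_split_of_inputs hGZ hKo hGZK hmod hnf hHL hMaz hPT hEP hMN
          (fun W _ _ ↦ hCL W) (fun W _ _ ↦ hCT W) hU W hX hsurj hdvd hnr hs
      · exact missingPPartAt_of_corner_nonsplit_of_inputs hGZ hKo hGZK hmod hnf hHL hMaz hPT hEP hMN
          (fun W _ _ ↦ hCL W) (fun W _ _ ↦ hCT W) hU W hX hsurj hdvd hnr hs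

/-! ### §2. The K2@3 leaf from the KOLY record, H3 ORIENTED -/

/-- **K2b leaf from the KOLY RECORD on the consumed bound, with the ORIENTED H3 atom.**
`multiplicativeRankOneAtThree_of_kolyRecord_upper` VERBATIM except that `hHb` (road (b) on the Tamagawa cells)
and `hHd` (road (d)) deliver `BDPValueAt₃ W ∧ IMCDivAt₃B W` and `StepLAt W` comes from
`stepLAt_of_halves₃_of_classX11bB`. Every other binder byte-identical (the Kolyvagin road `hA1` on A1; road (a)
`hReg`; `hDb`, `hUβ`, `hUα`, `hUγ`, `hDd`, `hU₀`; corner `hCL`, `hCT`, `hCU`). CONDITIONAL on every binder;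
nothing booked; O2 OPEN.
-- adapted from Summits/BirchSwinnertonDyer/BirchSwinnertonDyer/Theorems/ClassRecordThreeKernelUpper.lean (§3)
[cite: Castella2018, Thm. 2.3 (p. 5), Thm. 3.2 (p. 9), §5 (p. 12)] [cite: Skinner2016PacificMC, Thm. A and Thm. C (§1)]
[cite: McCallumLMS1991, §5 Cor. 5.6 (p. 310)] [cite: MatarNekovar2019, Thm. 0.3 (p. 456)] -/
theorem multiplicativeRankOneAtThree_of_kolyRecord_upperB
    -- PUBLISHED: the named facts of route p2, WITHOUT `hEP` (as v4.5′)
    (hGZ : ∀ (N : ℕ) [NeZero N] (W : WeierstrassCurve ℚ) (K : Type) [Field K] [NumberField K],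
      gross_zagier N W K)
    (hKo : ∀ (N : ℕ) [NeZero N] (W : WeierstrassCurve ℚ) (K : Type) [Field K] [NumberField K],
      kolyvagin N W K)
    (hB : ∀ (N : ℕ) [NeZero N] (W : WeierstrassCurve ℚ) (K : Type) [Field K] [NumberField K],
      Kolyvagin1990_padicValNat_card_sha_le N W K)
    (hSk : Skinner2016.thmC_padicValRat_bsd_rank_zero) (hWu : sha_dvd_analyticSha)
    (hGZK : rank_eq_analyticRank_of_analyticRank_le_one) (hmod : hasEntireLFunction_rat)
    (hnf : exists_isNewformOf) (hHL : HoffsteinLuo1997_exists_twist_L_one_ne_zero)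
    (hMaz : mazur_not_dvd_maninConstant_of_odd)
    (hPT : ∀ (K : Type) [Field K] [NumberField K], poitouTate_sum_localTatePairing_eq_zero K)
    -- PUBLISHED: road (a)'s five, Matar–Nekovář 2019 Thm. 0.3, Hsieh 2014 Thm. 1 (NO `hFH`, NO `hBR`)
    (hSkA : thmA_charIdeal_multiplicative) (hJn : thm61_nonsplitMultiplicative)
    (hHn : exists_isMultCanonical) (hD : thm1_padicBSD_rankOne_multiplicative)
    (hpar : nonempty_modularParametrizationData)
    (hMN : ∀ (N : ℕ) [NeZero N] (W : WeierstrassCurve ℚ) (K : Type) [Field K] [NumberField K],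
      MatarNekovar2019.thm03_padicValNat_card_sha_le_of_irreducible N W K)
    (hH : hsieh2014_exists_anticyclotomicPAdicLFunction)
    -- THE KOLYVAGIN ROAD on A1 = (ram) ∧ 3 ∤ ∏c
    (hA1 : ∀ (W : WeierstrassCurve ℚ) [W.IsElliptic] [W.IsGloballyMinimal],
      ClassX11b W 3 → Ram W 3 → ¬ 3 ∣ W.tamagawaProduct → BSDp W 3)
    -- ROAD (a) NONSPLIT(3) ∧ (ram) ∧ 3 ∣ ∏c: Schneider at 3, RESTRICTED to the Tamagawa cells
    (hReg : ∀ (W : WeierstrassCurve ℚ) [W.IsElliptic] [W.IsGloballyMinimal],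
      ClassX11b W 3 → Ram W 3 → ¬ W.HasSplitMultiplicativeReductionAtPrime 3 → 3 ∣ W.tamagawaProduct →
        ClassClosure.RegulatorNonvanishingAt W 3)
    -- ROAD (b) SPLIT(3) ∧ (ram): the named descent residual …
    (hDb : ∀ (W : WeierstrassCurve ℚ) [W.IsElliptic] [W.IsGloballyMinimal],
      ClassX11b W 3 → Ram W 3 → W.HasSplitMultiplicativeReductionAtPrime 3 → HsiehDescentAt₃ W)
    -- … and the halves H2 ∧ H3, RESTRICTED to the Tamagawa cells
    (hHb : ∀ (W : WeierstrassCurve ℚ) [W.IsElliptic] [W.IsGloballyMinimal],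
      ClassX11b W 3 → Ram W 3 → W.HasSplitMultiplicativeReductionAtPrime 3 → 3 ∣ W.tamagawaProduct →
        BDPValueAt₃ W ∧ IMCDivAt₃B W)
    -- pure-(T2β)@3 on split ∧ (ram): the CONSUMED Euler-system half (replaces the displays binder `hSh`)
    (hUβ : ∀ (W : WeierstrassCurve ℚ) [W.IsElliptic] [W.IsGloballyMinimal],
      ClassX11b W 3 → Ram W 3 → W.HasSplitMultiplicativeReductionAtPrime 3 → ¬ ShapeAlpha W →
        ¬ ShapeGamma W → 3 ∣ W.tamagawaProduct → Typed.MissingUpperBoundAt W 3)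
    -- (T2′)₃ Euler-system halves (as v4.5′)
    (hUα : ∀ (W : WeierstrassCurve ℚ) [W.IsElliptic] [W.IsGloballyMinimal],
      ClassX11b W 3 → Ram W 3 → ShapeAlpha W → Typed.MissingUpperBoundAt W 3)
    (hUγ : ∀ (W : WeierstrassCurve ℚ) [W.IsElliptic] [W.IsGloballyMinimal],
      ClassX11b W 3 → Ram W 3 → W.HasSplitMultiplicativeReductionAtPrime 3 → ¬ ShapeAlpha W →
        ShapeGamma W → Typed.MissingUpperBoundAt W 3)
    -- ROAD (d) `¬Ram ∧ Surj` (as v4.5′)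
    (hDd : ∀ (W : WeierstrassCurve ℚ) [W.IsElliptic] [W.IsGloballyMinimal],
      ClassX11b W 3 → ¬ Ram W 3 → Surj W 3 → HsiehDescentAt₃ W)
    (hHd : ∀ (W : WeierstrassCurve ℚ) [W.IsElliptic] [W.IsGloballyMinimal],
      ClassX11b W 3 → ¬ Ram W 3 → Surj W 3 → BDPValueAt₃ W ∧ IMCDivAt₃B W)
    (hU₀ : ∀ (W : WeierstrassCurve ℚ) [W.IsElliptic] [W.IsGloballyMinimal],
      ClassX11b W 3 → Surj W 3 → ¬ Ram W 3 → Typed.MissingUpperBoundAt W 3)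
    -- THE (T4″)@3 CORNER (as v4.5′)
    (hCL : ∀ (W : WeierstrassCurve ℚ) [W.IsElliptic] [W.IsGloballyMinimal], CornerStepLAt W)
    (hCT : ∀ (W : WeierstrassCurve ℚ) [W.IsElliptic] [W.IsGloballyMinimal], CornerTwistAt W)
    (hCU : ∀ (W : WeierstrassCurve ℚ) [W.IsElliptic] [W.IsGloballyMinimal], CornerUpperAt W) :
    MultiplicativeRankOneAtThree := by
  intro W _ _ hX
  have hEP : ∀ (K : Type) [Field K] [NumberField K] (v : HeightOneSpectrum (𝓞 K)),
      localEulerPoincareCharacteristic (v.adicCompletion K) :=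
    GaloisImage.EP.localEulerPoincareCharacteristic_adicCompletion
  by_cases hram : Ram W 3
  · by_cases htam : 3 ∣ W.tamagawaProduct
    · by_cases hs : W.HasSplitMultiplicativeReductionAtPrime 3
      · -- road (b) on the Tamagawa cells: StepLAt W from the named descent residual + H2 ∧ H3 at W
        have hL : StepLAt W :=
          stepLAt_of_halves₃_of_classX11bB hnf hKo hPT hEP hX
            (bdpExistsAt₃_of_hsieh2014_of_descent W hH lambdaSupplyAt₃ (hDb W hX hram hs))
            (hHb W hX hram hs htam).1 (hHb W hX hram hs htam).2
        exact Three.bsdp_three_of_surj_of_stepLAt_of_shapes_upper hGZ hKo hB hSk hWu hGZK hmod hnf hHL hMaz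
          hPT hEP W hX (surj_of_irr_of_ram W 3 hX.2.2.2 hram) hL
          (fun hram hα hγ ht ↦ hUβ W hX hram hs hα hγ ht) (fun hram hα ↦ hUα W hX hram hα)
          (fun hram hα hγ ↦ hUγ W hX hram hs hα hγ) (fun h ↦ absurd hram h)
      · -- road (a) on the Tamagawa cells
        exact bsdp_of_ram_of_nonsplit_of_regulatorNonvanishing hSkA hJn hHn hD hGZK hpar W 3 hX hram hs
          (hReg W hX hram hs htam)
    · -- A1: the Kolyvagin road decides
      exact hA1 W hX hram htam
  · by_cases hsurj : Surj W 3
    · -- road (d), as v4.5′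
      have hL₀ : StepLAt W :=
        stepLAt_of_halves₃_of_classX11bB hnf hKo hPT hEP hX
          (bdpExistsAt₃_of_hsieh2014_of_descent W hH lambdaSupplyAt₃ (hDd W hX hram hsurj))
          (hHd W hX hram hsurj).1 (hHd W hX hram hsurj).2
      exact Three.bsdp_three_of_surj_of_stepLAt_of_shapes_upper hGZ hKo hB hSk hWu hGZK hmod hnf hHL hMaz
        hPT hEP W hX hsurj hL₀ (fun h _ _ _ ↦ absurd h hram) (fun h _ ↦ absurd h hram)
        (fun h _ _ ↦ absurd h hram) (fun _ ↦ hU₀ W hX hsurj hram)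
    · -- the corner, as v4.1
      have hU : ∀ (W : WeierstrassCurve ℚ) [W.IsElliptic] [W.IsGloballyMinimal],
          ClassX11b W 3 → ¬ Surj W 3 → 3 ∣ W.tamagawaProduct → Typed.MissingUpperBoundAt W 3 :=
        fun W _ _ hX hns ht ↦
          missingUpperBoundAt_of_cornerUpperAt hGZ hKo hGZK hmod hnf hHL hMaz W hX hns ht (hCU W) (hCT W)
      obtain ⟨hdvd, hnr⟩ := ClassX11b.dvd_and_not_ram_of_not_surj W 3 hX hsurj
      refine Typed.bsdp_of_missingPPartAt W 3 hGZK (by rw [hX.1]) ?_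
      by_cases hs : W.HasSplitMultiplicativeReductionAtPrime 3
      · exact missingPPartAt_of_corner_split_of_inputs hGZ hKo hGZK hmod hnf hHL hMaz hPT hEP hMN
          (fun W _ _ ↦ hCL W) (fun W _ _ ↦ hCT W) hU W hX hsurj hdvd hnr hs
      · exact missingPPartAt_of_corner_nonsplit_of_inputs hGZ hKo hGZK hmod hnf hHL hMaz hPT hEP hMN
          (fun W _ _ ↦ hCL W) (fun W _ _ ↦ hCT W) hU W hX hsurj hdvd hnr hs

end Summit.BirchSwinnertonDyer.BirchSwinnertonDyer.Theorems

end
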